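import Summits.HubbardSuperconductivity.HubbardSuperconductivity.Theorems.AnisotropyChordTransferFibre3FinXDCheck

/-!
# Route `AnisotropyChord` / H0 rotor rung: FIN per-`L` row-D (KT-2a″) SUB-CELL facts, `L = 9` (30–35)

Row-D facts `xdCellAny0 9 (49/50) la lb aD = true` on quarter sub-cells of the combined cells whose side condition needs `aD ≈ .04` (mechhunt STATUS p3 g7 REPORT 3).
Prover seat `hubbard-h0-rotor-p3` g7; helper for piece A = stmt-HubbardSuperconductivity-23918 of rung 19089 (`--supports`, helper class).
WHAT THIS IS NOT: nothing here proves superconductivity in the Hubbard model (rotor TARGET as worded stays FALSE, g15 verdict); kernel facts /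
assembly for ONE conditional reduction at one `L`.  No sorry.
-/

set_option linter.dupNamespace false
set_option autoImplicit false

namespace Summit.HubbardSuperconductivity.HubbardSuperconductivity.Theorems.AnisotropyChord.Transfer.Fibre3

namespace FinXD

/-- row-D sub-cell `[12945128086092596, 13025036284154895]` of `L = 9`. [folklore] -/
theorem xd9s_118_2 : xdCellAny0 9 (49/50 : ℚ) 12945128086092596 13025036284154895 (1/25 : ℚ) = true := by decide +kernel

/-- row-D sub-cell `[13025036284154895, 13104944482217195]` of `L = 9`. [folklore] -/
theorem xd9s_118_3 : xdCellAny0 9 (49/50 : ℚ) 13025036284154895 13104944482217195 (1/25 : ℚ) = true := by decide +kernel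

/-- row-D sub-cell `[13104944482217195, 13186850385231052]` of `L = 9`. [folklore] -/
theorem xd9s_119_0 : xdCellAny0 9 (49/50 : ℚ) 13104944482217195 13186850385231052 (1/25 : ℚ) = true := by decide +kernel

/-- row-D sub-cell `[13186850385231052, 13268756288244910]` of `L = 9`. [folklore] -/
theorem xd9s_119_1 : xdCellAny0 9 (49/50 : ℚ) 13186850385231052 13268756288244910 (1/25 : ℚ) = true := by decide +kernel

/-- row-D sub-cell `[13268756288244910, 13350662191258767]` of `L = 9`. [folklore] -/
theorem xd9s_119_2 : xdCellAny0 9 (49/50 : ℚ) 13268756288244910 13350662191258767 (1/25 : ℚ) = true := by decide +kernel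

/-- row-D sub-cell `[13350662191258767, 13432568094272625]` of `L = 9`. [folklore] -/
theorem xd9s_119_3 : xdCellAny0 9 (49/50 : ℚ) 13350662191258767 13432568094272625 (1/25 : ℚ) = true := by decide +kernel

end FinXD

end Summit.HubbardSuperconductivity.HubbardSuperconductivity.Theorems.AnisotropyChord.Transfer.Fibre3
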